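import Summits.Schanuel.Schanuel.Theorems.RootDecomp1KNW96Core07
import Literature.NumberTheory.Transcendental.QuadraticRelationsLogarithmsMahlerWeil
import Literature.NumberTheory.Transcendental.PiAlgebraicApproximationMeasure

/-!
# RootDecomp1KNW96Core — lens 6, generation 23 «RAT-EXP SLOT BY PROOF» (RULE G24 (iii); CLAIM L2180/L2181, CHECKLIST G24-α = ACK L2182, NODE L2192 / REQUEST L2193, writer re-check L2196, critic VERDICT L2194: CLEARED — THEOREM ×1 (G24-α) «(α)-literal: `theorem explicitRatExpApprox_holds : RootDecomp1KHyper.HyperCell.ExplicitRatExpApprox` — the tree slot AS TYPED (Hyper06 l.75, constant `C₀rat`), HYPOTHESIS-FREE, axioms standard»; RULE G25; lens-6 tally THEOREM ×7 + CELL ×3 + AUDIT ×1) — continuation (RootDecomp1KNW96Core08): §7 RatExp — the c-generic slot, κNW, the derivation from NW1996MainR c, the instance at c = 400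

(lens-6 g23 HOME kernel K‴ = HOME/decomp-schanuel-lens-6/g23/g24/NW96RatExpSlot.lean 65615678…, 2391 l = K′ NW96Main.lean (graded L2175; tree parts 01–07) + §7 RatExp (l.2023–2337) + §8 Slot (l.2339–2387); K″ NW96RatExp.lean 2ce876f1… = K‴ minus the Hyper06 import and §8. Port by census-1 gen 19 as `RootDecomp1KNW96Core08` = §7 (imports Core07 + Literature QuadraticRelationsLogarithmsMahlerWeil + PiAlgebraicApproximationMeasure): the c-generic slot `ExplicitRatExpApproxC κ`, `.mono`, the DISPLAYED constant function `κNW c r = c · 4.63 · (7 + 2|r|) · (13 + 2 log max(1,|r|) + log max(|num r|, den r))`, the exponent lemmas F1/F2/F3, `κNW_margin`, the DERIVATION `ratExpC_of_mainR (hc : 1 ≤ c) (hNW : NW1996MainR c) : ExplicitRatExpApproxC (κNW c)` (θ = β = r, α = ξ; D = n by `NesterenkoWaldschmidt1996.finrank_adjoin_eq_natDegree`, heights by `RoyWaldschmidt1997.MahlerWeil.weilHeight₁_root_le`, BY NAME) and `explicitRatExpApproxC_400`; `RootDecomp1KNW96Core09` = §8 (imports Core08 + RootDecomp1KHyper06):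 `explicitRatExpApproxC_C₀rat_iff` (Iff.rfl), `κNW_400_le_C₀rat`, and the headline `explicitRatExpApprox_holds : ExplicitRatExpApprox` HYPOTHESIS-FREE.
PORT EDITS: the slot def's docstring tagged «[slot] definition with parameter; suppliers …» (census convention, verdict condition); statements and proofs verbatim; no `set_option` in §7/§8. `--supports stmt-Schanuel-33364`; no census credit carried; rung 0 — nothing here proves Schanuel. CONSEQUENCE OF RECORD (RULE G25 (i)): every `(hX : ExplicitRatExpApprox)` binder in the tree is dischargeable BY NAME `explicitRatExpApprox_holds` — census relabel bookkeeping ×0.)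
-/

noncomputable section

open Finset

namespace Summit.Schanuel.Schanuel.Theorems.RootDecomp1KNW96Core

open Literature.NumberTheory.Transcendental

/-! ## §7. The rational-exponent slot BY PROOF (RULE G24 (iii), VERDICT L2175): from Theorem 1 with constant `c`
to the tree slot shape `ExplicitRatExpApprox` with a DISPLAYED constant function `κNW c`; hypothesis-free at `c = 400`.

Derivation (print §5 at a rational exponent): `θ = β = r ∈ ℚ∖{0}`, `α = ξ` a root of an irreducible `Q ∈ ℤ[X]`
of degree `n ≥ 1`, `log M(Q) ≤ Y`, `Y ≥ log 16 (≥ e)`; `K = ℚ(ξ, r) = ℚ(ξ)`, `D = n`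
(`NesterenkoWaldschmidt1996.finrank_adjoin_eq_natDegree`), `h(ξ) ≤ log M(Q)/n ≤ Y/n`
(`RoyWaldschmidt1997.MahlerWeil.weilHeight₁_root_le`), `h(r) ≤ H := log max(|num r|, den r)` (same lemma on
`den·X − num`); parameters `E := Y`, `log A := Y/n`, `B := max(|num r|, den r)`; then `|θ − β| = 0` and the
exponent of Theorem 1 is at most `κNW c r · n² · Y · (log Y + log n)² / (log Y)²` with
`κNW c r = c · 4.63 · (7 + 2|r|) · (13 + 2 log max(1,|r|) + H)`; the corner `ξ = 0` needs no fact. -/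

section RatExp

open Polynomial

/-- [slot] definition with parameter; suppliers: BY PROOF `explicitRatExpApproxC_400 : ExplicitRatExpApproxC (κNW 400)` (§7 below, from `nw1996MainR_400`), whence the tree record hypothesis `ExplicitRatExpApprox` (Hyper06) via `κNW_400_le_C₀rat` (part 09). A DEFINITION with a parameter, NOT a fact (no cite tag). The tree slot `RootDecomp1KHyper.HyperCell.ExplicitRatExpApprox` (Hyper06) with its constant `C₀rat r`
replaced by a displayed function `κ r` (read-back `ExplicitRatExpApproxC C₀rat ↔ ExplicitRatExpApprox` is
`Iff.rfl`, probe). -/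
def ExplicitRatExpApproxC (κ : ℚ → ℝ) : Prop :=
  ∀ r : ℚ, r ≠ 0 → ∀ Q : ℤ[X], Irreducible Q → 0 < Q.natDegree → ∀ ξ : ℂ, aeval ξ Q = 0 →
    ∀ Y : ℝ, Real.log 16 ≤ Y → Real.log (Q.map (Int.castRingHom ℂ)).mahlerMeasure ≤ Y →
      Real.exp (-(κ r * (Q.natDegree : ℝ) ^ 2 * Y *
        (Real.log Y + Real.log Q.natDegree) ^ 2 / Real.log Y ^ 2)) ≤ ‖Complex.exp (r : ℂ) - ξ‖

/-- Monotonicity of the slot in the constant function (a larger constant is a weaker measure). -/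
theorem ExplicitRatExpApproxC.mono {κ κ' : ℚ → ℝ} (h : ExplicitRatExpApproxC κ) (hκ : ∀ r, κ r ≤ κ' r) :
    ExplicitRatExpApproxC κ' := by
  intro r hr Q hQ hn ξ hξ Y hY hM
  refine le_trans (Real.exp_le_exp.mpr (neg_le_neg ?_)) (h r hr Q hQ hn ξ hξ Y hY hM)
  have hY0 : 0 ≤ Y := le_trans (Real.log_nonneg (by norm_num)) hY
  have hT : 0 ≤ (Q.natDegree : ℝ) ^ 2 * Y * (Real.log Y + Real.log Q.natDegree) ^ 2 / Real.log Y ^ 2 := by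
    positivity
  have := mul_le_mul_of_nonneg_right (hκ r) hT
  calc κ r * (Q.natDegree : ℝ) ^ 2 * Y * (Real.log Y + Real.log Q.natDegree) ^ 2 / Real.log Y ^ 2
      = κ r * ((Q.natDegree : ℝ) ^ 2 * Y * (Real.log Y + Real.log Q.natDegree) ^ 2 / Real.log Y ^ 2) := by
        ring
    _ ≤ κ' r * ((Q.natDegree : ℝ) ^ 2 * Y * (Real.log Y + Real.log Q.natDegree) ^ 2 / Real.log Y ^ 2) :=
        this
    _ = _ := by ring

/-- The DISPLAYED constant function of the derivation:
`κNW c r = c · (463/100) · (7 + 2|r|) · (13 + 2·log max(1,|r|) + log max(|num r|, den r))`. -/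
def κNW (c : ℝ) (r : ℚ) : ℝ :=
  c * (463 / 100) * (7 + 2 * |(r : ℝ)|) *
    (13 + 2 * Real.log (max 1 |(r : ℝ)|) + Real.log (max (|(r.num : ℝ)|) (r.den : ℝ)))

/-- The linear integer polynomial `den(r)·X − num(r)` of a rational number `r` is irreducible
(as in `RootDecomp1KHyper19`, where it is private). -/
theorem irreducible_den_mul_X_sub_num' (r : ℚ) :
    Irreducible (C (r.den : ℤ) * X + C (-r.num) : ℤ[X]) := by
  have hden : (r.den : ℤ) ≠ 0 := by exact_mod_cast r.den_ne_zero
  have hprim : (C (r.den : ℤ) * X + C (-r.num) : ℤ[X]).IsPrimitive := by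
    intro c hc
    rw [C_dvd_iff_dvd_coeff] at hc
    have h1 : c ∣ (r.den : ℤ) := by
      have := hc 1
      rwa [coeff_add, coeff_C_mul, coeff_X_one, mul_one, coeff_C, if_neg one_ne_zero,
        add_zero] at this
    have h0 : c ∣ r.num := by
      have := hc 0
      rwa [coeff_add, coeff_C_mul, coeff_X_zero, mul_zero, zero_add, coeff_C_zero, dvd_neg] at this
    obtain ⟨u, v, huv⟩ := Rat.isCoprime_num_den r
    exact isUnit_of_dvd_one
      (huv ▸ dvd_add (dvd_mul_of_dvd_right h0 u) (dvd_mul_of_dvd_right h1 v))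
  rw [hprim.irreducible_iff_irreducible_map_fraction_map (K := ℚ)]
  apply irreducible_of_degree_eq_one
  rw [degree_map_eq_of_injective (algebraMap ℤ ℚ).injective_int]
  rw [degree_add_eq_left_of_degree_lt] <;> rw [degree_C_mul_X hden]
  exact degree_C_le.trans_lt (by norm_num)

/-- `h_F(r) ≤ log max(|num r|, den r)` for a rational `r` in a number field `F ⊂ ℂ`
(as in `RootDecomp1KHyper19`, where it is private; via `MahlerWeil.weilHeight₁_root_le` on `den·X − num`). -/
theorem weilHeight₁_ratCast_le' (F : IntermediateField ℚ ℂ) [FiniteDimensional ℚ F] (r : ℚ)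
    (hr : (r : ℂ) ∈ F) :
    weilHeight₁ F (fun _ : Unit => (r : ℂ)) ≤ Real.log (max (|(r.num : ℝ)|) (r.den : ℝ)) := by
  have hden : (r.den : ℤ) ≠ 0 := by exact_mod_cast r.den_ne_zero
  have hPdeg : (C (r.den : ℤ) * X + C (-r.num) : ℤ[X]).natDegree = 1 := by
    rw [natDegree_add_C, natDegree_C_mul_X _ hden]
  have hroot : aeval (r : ℂ) (C (r.den : ℤ) * X + C (-r.num) : ℤ[X]) = 0 := by
    rw [map_add, map_mul, aeval_X, aeval_C, aeval_C, algebraMap_int_eq, eq_intCast, eq_intCast,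
      Int.cast_neg, Int.cast_natCast]
    have : (r : ℂ) * (r.den : ℂ) = (r.num : ℂ) := by exact_mod_cast Rat.mul_den_eq_num r
    linear_combination this
  have h1 := RoyWaldschmidt1997.MahlerWeil.weilHeight₁_root_le _ (irreducible_den_mul_X_sub_num' r)
    (by rw [hPdeg]; exact one_pos) hroot F hr
  have hmap : (C (r.den : ℤ) * X + C (-r.num) : ℤ[X]).map (Int.castRingHom ℂ) =
      C (r.den : ℂ) * X + C (-(r.num : ℂ)) := by
    simp [Polynomial.map_add, Polynomial.map_mul]
  have hM : ((C (r.den : ℤ) * X + C (-r.num) : ℤ[X]).map (Int.castRingHom ℂ)).mahlerMeasure =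
      max (|(r.num : ℝ)|) (r.den : ℝ) := by
    rw [hmap, mahlerMeasure_C_mul_X_add_C (by exact_mod_cast r.den_ne_zero), norm_neg,
      Complex.norm_natCast, Complex.norm_intCast, max_comm]
  rw [hM, hPdeg, Nat.cast_one, div_one] at h1
  exact h1

/-- `e ≤ log 16` (so `Y ≥ log 16` is an admissible `E` in Theorem 1). -/
private theorem exp_one_le_log_sixteen' : Real.exp 1 ≤ Real.log 16 := by
  have h1 := Real.exp_one_lt_d9
  have h2 := Real.log_two_gt_d9
  have h16 : Real.log 16 = (4 : ℕ) * Real.log 2 := by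
    rw [show (16 : ℝ) = 2 ^ 4 by norm_num, Real.log_pow]
  rw [h16]; push_cast; linarith

/-- `log(n+2) ≤ log n + 1.1` for `n ≥ 1` (via `n + 2 ≤ 3n` and `log 3 ≤ 11/10`; at `n = 1` it reads
`log 3 ≤ 0 + 1.1`, true since `log 3 = 1.0986…`). -/
theorem log_add_two_le {n : ℝ} (hn : 1 ≤ n) : Real.log (n + 2) ≤ Real.log n + 11 / 10 := by
  have hn0 : 0 < n := by linarith
  have hlog3 : Real.log 3 ≤ 11 / 10 := by
    have := log_le_div_of_pow_le (x := 3) (by norm_num) 11 10 (by norm_num) (by norm_num)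
    norm_num at this; linarith
  have h3n : n + 2 ≤ 3 * n := by linarith
  have := Real.log_le_log (by linarith) h3n
  rw [Real.log_mul (by norm_num) hn0.ne'] at this
  linarith

/-- **F1** (the `log B + log log A + 4 log D + 2 log(E·max(1,|θ|)) + 10` factor at `log B = H`, `log A = Y/n`,
`D = n`, `E = Y`, `|θ| ≤ m := max(1,|r|)`): it EQUALS `H + 3(log Y + log n) + 2 log m + 10` and is at most
`(13 + 2 log m + H)·(log Y + log n)` (since `log Y + log n ≥ 1`). -/
theorem ratExp_F1_le {n Y H m : ℝ} (hn : 1 ≤ n) (hY : 1 < Y) (hL : 1 ≤ Real.log Y) (hH : 0 ≤ H)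
    (hm : 1 ≤ m) :
    H + Real.log (Y / n) + 4 * Real.log n + 2 * Real.log (Y * m) + 10 =
        H + 3 * (Real.log Y + Real.log n) + 2 * Real.log m + 10 ∧
      H + Real.log (Y / n) + 4 * Real.log n + 2 * Real.log (Y * m) + 10 ≤
        (13 + 2 * Real.log m + H) * (Real.log Y + Real.log n) := by
  have hn0 : 0 < n := by linarith
  have hY0 : 0 < Y := by linarith
  have hm0 : 0 < m := by linarith
  have hlogn : 0 ≤ Real.log n := Real.log_nonneg hn
  have hlogm : 0 ≤ Real.log m := Real.log_nonneg hm
  have e1 : H + Real.log (Y / n) + 4 * Real.log n + 2 * Real.log (Y * m) + 10 =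
      H + 3 * (Real.log Y + Real.log n) + 2 * Real.log m + 10 := by
    rw [Real.log_div hY0.ne' hn0.ne', Real.log_mul hY0.ne' hm0.ne']; ring
  refine ⟨e1, ?_⟩
  rw [e1]; nlinarith

/-- **F2** (the `D log A + 2E|θ| + 6 log E` factor): `n·(Y/n) + 2Y·a + 6 log Y ≤ (7 + 2a)·Y` (`log Y ≤ Y`; any real `a`,
used at `a = |r|`). -/
theorem ratExp_F2_le {n Y : ℝ} (a : ℝ) (hn : 1 ≤ n) (hY : 1 < Y) :
    n * (Y / n) + 2 * Y * a + 6 * Real.log Y ≤ (7 + 2 * a) * Y := by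
  have hn0 : 0 < n := by linarith
  have hY0 : 0 < Y := by linarith
  have hlogY : Real.log Y ≤ Y := by linarith [Real.log_le_sub_one_of_pos hY0]
  rw [mul_div_cancel₀ Y hn0.ne']; nlinarith

/-- **F3** (the `3.3 D log(D+2) + log E` factor): `3.3 n log(n+2) + log Y ≤ 4.63·n·(log Y + log n)`
(`log(n+2) ≤ log n + 1.1`, `log n + 1.1 ≤ 1.1 (log Y + log n)` as `log Y ≥ 1`, so `3.3 n log(n+2) ≤ 3.63 n S`;
and `log Y ≤ S ≤ n S`; the corner `n = 1`, `Y = log 16` needs the coefficient `≥ 4.55`, control X4). -/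
theorem ratExp_F3_le {n Y : ℝ} (hn : 1 ≤ n) (hL : 1 ≤ Real.log Y) :
    33 / 10 * n * Real.log (n + 2) + Real.log Y ≤ 463 / 100 * n * (Real.log Y + Real.log n) := by
  have hn0 : 0 < n := by linarith
  have hlogn : 0 ≤ Real.log n := Real.log_nonneg hn
  have k1 : n * Real.log (n + 2) ≤ n * (Real.log n + 11 / 10) :=
    mul_le_mul_of_nonneg_left (log_add_two_le hn) hn0.le
  have k2 : Real.log n + 11 / 10 ≤ 11 / 10 * (Real.log Y + Real.log n) := by linarith
  have k3 : n * (Real.log n + 11 / 10) ≤ n * (11 / 10 * (Real.log Y + Real.log n)) :=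
    mul_le_mul_of_nonneg_left k2 hn0.le
  have k4 : Real.log Y ≤ n * (Real.log Y + Real.log n) := by nlinarith
  nlinarith

/-- The EXPONENT COMPARISON of the derivation (pure real arithmetic): with `n ≥ 1`, `log Y ≥ 1`, `1 < Y`,
`H, log m ≥ 0`, `a ≥ 0`, `c ≥ 0`, the exponent of Theorem 1 at `(D, log A, log B, E, ‖θ‖) = (n, Y/n, H, Y, a)`
is at most `κ · n²·Y·(log Y + log n)²/(log Y)²` with `κ = c·4.63·(7+2a)·(13 + 2 log m + H)`. -/
theorem ratExp_exponent_le {c n Y H m a : ℝ} (hc : 0 ≤ c) (hn : 1 ≤ n) (hY : 1 < Y) (hL : 1 ≤ Real.log Y)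
    (hH : 0 ≤ H) (hm : 1 ≤ m) (ha : 0 ≤ a) :
    c * n * (H + Real.log (Y / n) + 4 * Real.log n + 2 * Real.log (Y * m) + 10) *
        (n * (Y / n) + 2 * Y * a + 6 * Real.log Y) * (33 / 10 * n * Real.log (n + 2) + Real.log Y) /
        Real.log Y ^ 2 ≤
      c * (463 / 100) * (7 + 2 * a) * (13 + 2 * Real.log m + H) * n ^ 2 * Y *
        (Real.log Y + Real.log n) ^ 2 / Real.log Y ^ 2 := by
  have hn0 : 0 < n := by linarith
  have hY0 : 0 < Y := by linarith
  have hm0 : 0 < m := by linarith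
  have hlogn : 0 ≤ Real.log n := Real.log_nonneg hn
  have hlogm : 0 ≤ Real.log m := Real.log_nonneg hm
  have hL0 : 0 ≤ Real.log Y := by linarith
  set S : ℝ := Real.log Y + Real.log n with hSdef
  have hS1 : 1 ≤ S := by rw [hSdef]; linarith
  obtain ⟨e1, f1⟩ := ratExp_F1_le hn hY hL hH hm
  have f1pos : 0 ≤ H + Real.log (Y / n) + 4 * Real.log n + 2 * Real.log (Y * m) + 10 := by
    rw [e1]; positivity
  have f2 := ratExp_F2_le a hn hY
  have f2pos : 0 ≤ n * (Y / n) + 2 * Y * a + 6 * Real.log Y := by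
    rw [mul_div_cancel₀ Y hn0.ne']; positivity
  have f3 := ratExp_F3_le hn hL
  have f3pos : 0 ≤ 33 / 10 * n * Real.log (n + 2) + Real.log Y := by
    have : 0 ≤ Real.log (n + 2) := Real.log_nonneg (by linarith)
    positivity
  have g1 : 0 ≤ (13 + 2 * Real.log m + H) * S := by positivity
  have g2 : 0 ≤ (7 + 2 * a) * Y := by positivity
  have hcn : 0 ≤ c * n := mul_nonneg hc hn0.le
  have p1 := mul_le_mul_of_nonneg_left f1 hcn
  have p2 := mul_le_mul p1 f2 f2pos (mul_nonneg hcn g1)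
  have p3 := mul_le_mul p2 f3 f3pos (mul_nonneg (mul_nonneg hcn g1) g2)
  have e : c * n * ((13 + 2 * Real.log m + H) * S) * ((7 + 2 * a) * Y) * (463 / 100 * n * S) =
      c * (463 / 100) * (7 + 2 * a) * (13 + 2 * Real.log m + H) * n ^ 2 * Y * S ^ 2 := by ring
  rw [e] at p3
  exact div_le_div_of_nonneg_right p3 (by positivity)

/-- The margin at the corner `ξ = 0`: `κNW c r ≥ 120·c·|r|` (indeed `c·4.63·2|r|·13 = 120.38·c·|r|`), so for
`c ≥ 1` the slot's exponent dominates `|r|` and `‖e^r − 0‖ = e^r ≥ e^{−|r|}` suffices — no fact needed there. -/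
theorem κNW_margin {c : ℝ} (hc : 0 ≤ c) (r : ℚ) : 120 * c * |(r : ℝ)| ≤ κNW c r := by
  unfold κNW
  have hden1 : (1 : ℝ) ≤ r.den := by exact_mod_cast r.pos
  have hH0 : 0 ≤ Real.log (max (|(r.num : ℝ)|) (r.den : ℝ)) := Real.log_nonneg (le_max_of_le_right hden1)
  have hlogm0 : 0 ≤ Real.log (max 1 |(r : ℝ)|) := Real.log_nonneg (le_max_left _ _)
  have habs : 0 ≤ |(r : ℝ)| := abs_nonneg _
  have k1 : 120 * c * |(r : ℝ)| ≤ c * (463 / 100) * (7 + 2 * |(r : ℝ)|) * 13 := by nlinarith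
  have k2 : c * (463 / 100) * (7 + 2 * |(r : ℝ)|) * 13 ≤ c * (463 / 100) * (7 + 2 * |(r : ℝ)|) *
      (13 + 2 * Real.log (max 1 |(r : ℝ)|) + Real.log (max (|(r.num : ℝ)|) (r.den : ℝ))) :=
    mul_le_mul_of_nonneg_left (by linarith) (by positivity)
  linarith

/-- **NW96 Theorem 1 (constant `c ≥ 1`) ⟹ the rational-exponent slot with constant `κNW c`.** -/
theorem ratExpC_of_mainR {c : ℝ} (hc : 1 ≤ c) (hNW : NW1996MainR c) : ExplicitRatExpApproxC (κNW c) := by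
  intro r hr Q hQ hn ξ hξ Y hY16 hMY
  -- numerics of `Y`, `n`
  have heY : Real.exp 1 ≤ Y := exp_one_le_log_sixteen'.trans hY16
  have hY1 : 1 < Y := by linarith [Real.add_one_le_exp (1 : ℝ)]
  have hY0 : 0 < Y := by linarith
  have hL1 : 1 ≤ Real.log Y := (Real.le_log_iff_exp_le hY0).mpr heY
  have hL0 : 0 < Real.log Y := by linarith
  have hn1 : (1 : ℝ) ≤ Q.natDegree := by exact_mod_cast hn
  have hn0 : (0 : ℝ) < Q.natDegree := by linarith
  have hln0 : 0 ≤ Real.log Q.natDegree := Real.log_nonneg hn1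
  -- constants attached to `r`
  have hden1 : (1 : ℝ) ≤ r.den := by exact_mod_cast r.pos
  have hB0 : (0 : ℝ) < max (|(r.num : ℝ)|) (r.den : ℝ) := lt_of_lt_of_le one_pos (le_max_of_le_right hden1)
  have hH0 : 0 ≤ Real.log (max (|(r.num : ℝ)|) (r.den : ℝ)) := Real.log_nonneg (le_max_of_le_right hden1)
  have hm1 : (1 : ℝ) ≤ max 1 |(r : ℝ)| := le_max_left _ _
  have hlogm0 : 0 ≤ Real.log (max 1 |(r : ℝ)|) := Real.log_nonneg hm1
  have habs : 0 ≤ |(r : ℝ)| := abs_nonneg _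
  have hc0 : (0 : ℝ) ≤ c := by linarith
  -- the slot's exponent dominates `|r|`
  set TT : ℝ := (Q.natDegree : ℝ) ^ 2 * Y * (Real.log Y + Real.log Q.natDegree) ^ 2 / Real.log Y ^ 2
    with hTTdef
  have hTT1 : 1 ≤ TT := by
    rw [hTTdef, le_div_iff₀ (by positivity), one_mul]
    have h1 : Real.log Y ^ 2 ≤ (Real.log Y + Real.log Q.natDegree) ^ 2 :=
      pow_le_pow_left₀ hL0.le (by linarith) 2
    have h2 : 1 ≤ (Q.natDegree : ℝ) ^ 2 * Y := one_le_mul_of_one_le_of_one_le (one_le_pow₀ hn1) hY1.le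
    nlinarith [sq_nonneg (Real.log Y + Real.log Q.natDegree)]
  have hκr : |(r : ℝ)| ≤ κNW c r := by
    have := κNW_margin hc0 r
    nlinarith
  have hκ0 : 0 ≤ κNW c r := habs.trans hκr
  have ereshape : κNW c r * (Q.natDegree : ℝ) ^ 2 * Y * (Real.log Y + Real.log Q.natDegree) ^ 2 /
      Real.log Y ^ 2 = κNW c r * TT := by rw [hTTdef]; ring
  -- the corner `ξ = 0`: `‖e^r‖ = e^r ≥ e^{−|r|}`, no fact needed
  by_cases hξ0 : ξ = 0
  · subst hξ0
    rw [sub_zero, Complex.norm_exp, Complex.ratCast_re, ereshape]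
    refine Real.exp_le_exp.mpr ?_
    have h1 : |(r : ℝ)| ≤ κNW c r * TT := by
      calc |(r : ℝ)| ≤ κNW c r * 1 := by rw [mul_one]; exact hκr
        _ ≤ κNW c r * TT := mul_le_mul_of_nonneg_left hTT1 hκ0
    linarith [neg_abs_le (r : ℝ)]
  -- algebraic data (as in `RootDecomp1KHyper19.explicitRatExpApprox_of_NW1996`)
  have hξalg : IsAlgebraic ℚ ξ := by
    refine ⟨Q.map (Int.castRingHom ℚ),
      (Polynomial.map_ne_zero_iff (Int.castRingHom ℚ).injective_int).mpr hQ.ne_zero, ?_⟩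
    rw [← algebraMap_int_eq, aeval_map_algebraMap]; exact hξ
  have hralg : IsAlgebraic ℚ (r : ℂ) := by
    have := isAlgebraic_algebraMap (R := ℚ) (A := ℂ) r
    rwa [eq_ratCast] at this
  have hr0 : (r : ℂ) ≠ 0 := by exact_mod_cast hr
  have hKeq : IntermediateField.adjoin ℚ ({ξ, (r : ℂ)} : Set ℂ) =
      IntermediateField.adjoin ℚ ({ξ} : Set ℂ) := by
    apply le_antisymm
    · rw [IntermediateField.adjoin_le_iff]
      intro x hx
      rcases Set.mem_insert_iff.mp hx with rfl | hx'
      · exact IntermediateField.mem_adjoin_simple_self ℚ _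
      · rw [Set.mem_singleton_iff.mp hx', SetLike.mem_coe, ← eq_ratCast (algebraMap ℚ ℂ) r]
        exact (IntermediateField.adjoin ℚ ({ξ} : Set ℂ)).algebraMap_mem r
    · exact IntermediateField.adjoin.mono ℚ _ _ (Set.singleton_subset_iff.mpr (Set.mem_insert ξ _))
  have hD : Module.finrank ℚ (IntermediateField.adjoin ℚ ({ξ} : Set ℂ)) = Q.natDegree :=
    NesterenkoWaldschmidt1996.finrank_adjoin_eq_natDegree hQ hn hξ
  haveI : FiniteDimensional ℚ (IntermediateField.adjoin ℚ ({ξ} : Set ℂ)) :=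
    IntermediateField.adjoin.finiteDimensional (isAlgebraic_iff_isIntegral.mp hξalg)
  have hξK : ξ ∈ IntermediateField.adjoin ℚ ({ξ} : Set ℂ) :=
    IntermediateField.mem_adjoin_simple_self ℚ ξ
  have hrK : (r : ℂ) ∈ IntermediateField.adjoin ℚ ({ξ} : Set ℂ) := by
    rw [← eq_ratCast (algebraMap ℚ ℂ) r]
    exact (IntermediateField.adjoin ℚ ({ξ} : Set ℂ)).algebraMap_mem r
  -- heights
  have hhξ : weilHeight₁ (IntermediateField.adjoin ℚ ({ξ} : Set ℂ)) (fun _ : Unit => ξ) ≤ Y / Q.natDegree :=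
    (RoyWaldschmidt1997.MahlerWeil.weilHeight₁_root_le Q hQ hn hξ _ hξK).trans
      (div_le_div_of_nonneg_right hMY hn0.le)
  have hhr : weilHeight₁ (IntermediateField.adjoin ℚ ({ξ} : Set ℂ)) (fun _ : Unit => (r : ℂ)) ≤
      Real.log (max (|(r.num : ℝ)|) (r.den : ℝ)) := weilHeight₁_ratCast_le' _ r hrK
  -- Theorem 1 at `θ = β = r`, `α = ξ`, `A = exp(Y/n)`, `B = max(|num r|, den r)`, `E = Y`
  have h5 := hNW (r : ℂ) ξ (r : ℂ) (Real.exp (Y / Q.natDegree)) (max (|(r.num : ℝ)|) (r.den : ℝ)) Y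
    hr0 hξ0 hr0 hξalg hralg (Real.exp_pos _) hB0 heY
  rw [hKeq, hD] at h5
  have hAh : max (weilHeight₁ (IntermediateField.adjoin ℚ ({ξ} : Set ℂ)) (fun _ : Unit => ξ))
      (1 / (Q.natDegree : ℝ)) ≤ Real.log (Real.exp (Y / Q.natDegree)) := by
    rw [Real.log_exp]
    exact max_le hhξ (div_le_div_of_nonneg_right hY1.le hn0.le)
  have h := h5 hAh hhr
  rw [Real.log_exp, sub_self, norm_zero, add_zero, Complex.norm_ratCast] at h
  refine le_trans (Real.exp_le_exp.mpr (neg_le_neg ?_)) h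
  -- the exponent comparison
  have hmain := ratExp_exponent_le (c := c) (n := (Q.natDegree : ℝ)) (Y := Y)
    (H := Real.log (max (|(r.num : ℝ)|) (r.den : ℝ))) (m := max 1 |(r : ℝ)|) (a := |(r : ℝ)|)
    hc0 hn1 hY1 hL1 hH0 hm1 habs
  have eκ : c * (463 / 100) * (7 + 2 * |(r : ℝ)|) *
      (13 + 2 * Real.log (max 1 |(r : ℝ)|) + Real.log (max (|(r.num : ℝ)|) (r.den : ℝ))) = κNW c r := rfl
  rw [eκ] at hmain
  exact hmain

/-- **The rational-exponent slot, HYPOTHESIS-FREE, constant `κNW 400`** (from `nw1996MainR_400`). -/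
theorem explicitRatExpApproxC_400 : ExplicitRatExpApproxC (κNW 400) :=
  ratExpC_of_mainR (by norm_num) nw1996MainR_400

end RatExp

end Summit.Schanuel.Schanuel.Theorems.RootDecomp1KNW96Core

end
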